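import Summits.Ventures.Crystal3D.Theorems.StickyWulffConstantCoaxialWallLawSeamPayerFloor
import HarnessLib

/-!
# The repaired input with the TWO-PAYER FLOOR, in the STANDARD FRAME / WINDOW forms: `UnionCoreStarCapStd s`, `UnionCoreStarCapWin s` ⇒ both T5b stubs (under E1)
# (crux `CoaxialWallLaw`, stmt-Ventures-19481; line `WallLedgerF`, skeleton 'CoaxialWallLawCertificates', repair of the refuted v8.2 input `stub_unionCoreCap`)

HONEST FRAMING. Venture `Summits/Ventures/Crystal3D` (cell `crystal3d-full`); sequel of '…SeamPayerFloor' (`UnionCoreStarCap s`, payer floor `1`).  Two improvements,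
both pure bookkeeping, and the forms the certificate owner should actually be handed:
(1) TWO-PAYER FLOOR.  A loaded ball `b ≠ z` carries the exported two-payer clause `HasTwoPayers Y b` (it is part of `IsEndPairA`), so its true pool is `≥ 2`
    (`two_le_pooledDef_of_hasTwoPayers`: either `b` itself and the payer `z` are deficient, or two distinct deficient neighbours of `b` are); the floored pool used
    here is `payerPool₂ = payerPool` at `b = z` and `max 2 payerPool` at `b ≠ z` (`payerPool₂_le_pooledDef`).  This matters exactly for THIN TWIN-READER pieces: a
    hexagon ball of a bare anticuboctahedral (hcp) cluster has the equatorial `hStar` contact figure, which is NOT a closed slot star (two of its contacts meet at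
    inner product `−1/3`), so the E1 star row gives it no certified gain (rightly: `hStar` has non-exact twelve-completions, '…GenericWallFloorHStarRefuted') and
    the floor is all the certificate can book there — `2` per loaded ball instead of `1`.
(2) STANDARD FRAME / WINDOW.  The (A)-summand, degrees and separation transport under rigid motions (`localSummandA_transport`, `degree_transport`) and the summand at
    a payer depends only on the balls within `3` (`localSummandA_congr_of_agree`), so it suffices to certify the functional for the STANDARD systems
    (`basalSystem refl`, `basalSystem H`) at the payer `0` of a `1`-separated `Y ⊆ B̄(0, 3)` — the certificate's literal universe.
`P5Exhaustion` (E1, registered `stub_E1`) is a hypothesis of the consequences.  Nothing about the stubs is claimed; the inputs are OPEN; F-C1 not moved.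
* `two_le_pooledDef_of_hasTwoPayers`; `payerPool₂`, `payerSummand₂`, `payerPool₂_le_pooledDef`, `payerSummand₂_le_payerSummand`,
  **`localSummandA_le_payerSummand₂_unionCoreStar (hE1)`** — `Σ_A(Y, z) ≤ payerSummand₂ capTable₃ (unionCoreStar Y z) z` at every payer of degree `≤ 11`;
* **`UnionCoreStarCapStd s`** (standard frame, all payers) and **`UnionCoreStarCapWin s`** (payer `0`, `Y ⊆ B̄(0,3)`) — NAMED INPUTS with the two-payer floor;
  `unionCoreStarCapStd_of_cap : UnionCoreStarCap s → UnionCoreStarCapStd s`, `unionCoreStarCapWin_of_std`, monotonicity;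
* **`localSummandA_le_of_unionCoreStarCapStd / …Win (hE1)`** — `Σ_A(Y, z) ≤ s` for EVERY frame and payer; `seamResidual_of_…`, `coherentSeamSmall_of_…`,
  `incoherentSeamSmall_of_…`, **`t5b_of_unionCoreStarCapStd / t5b_of_unionCoreStarCapWin (hE1) (h : … (2 * Real.sqrt 6))`** — both registered T5b stubs BY NAME.
WHY IT MIGHT STILL FAIL (numerics pending, kit j334730): `N` bare twin-reader clusters each touching one payer with two loaded hexagon balls cost `2N · ½ = N` in this
functional; the input at line `2√6` needs `N ≤ 4` such clusters (plus the payer's own term) to be the geometric maximum.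
-/

noncomputable section

namespace Summit.Ventures.Crystal3D.Theorems

namespace TailResidue

open Summit.Ventures.Crystal3D Finset
open scoped InnerProductSpace

/-! ### The two-payer floor -/

open scoped Classical in
/-- **A loaded ball other than the payer has true pool `≥ 2`**: by the two-payer clause either the ball and the payer are two distinct deficient balls within `1`,
or two distinct deficient neighbours of the ball are. -/
theorem two_le_pooledDef_of_hasTwoPayers {X : Finset (EuclideanSpace ℝ (Fin 3))} {z b : EuclideanSpace ℝ (Fin 3)} (hz : z ∈ X)
    (hdeg : (X.filter fun q => dist z q = 1).card ≤ 11) (hzb : dist z b ≤ 1) (hbz : b ≠ z) (hb : b ∈ X) (hpay : HasTwoPayers X b) : 2 ≤ pooledDef X b := by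
  set S := X.filter (fun y => dist b y ≤ 1 ∧ (X.filter fun q => dist y q = 1).card ≤ 11) with hS
  have hcard : 2 ≤ S.card := by
    rcases hpay with hle | ⟨z₁, hz₁, z₂, hz₂, hne, hd₁, hd₂, hdeg₁, hdeg₂⟩
    · have hsub : ({b, z} : Finset (EuclideanSpace ℝ (Fin 3))) ⊆ S :=
        insert_subset (mem_filter.2 ⟨hb, by simp, hle⟩) (singleton_subset_iff.2 (mem_filter.2 ⟨hz, by rwa [dist_comm], hdeg⟩))
      exact (card_pair hbz).symm.le.trans (card_le_card hsub)
    · have hsub : ({z₁, z₂} : Finset (EuclideanSpace ℝ (Fin 3))) ⊆ S :=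
        insert_subset (mem_filter.2 ⟨hz₁, hd₁.le, hdeg₁⟩) (singleton_subset_iff.2 (mem_filter.2 ⟨hz₂, hd₂.le, hdeg₂⟩))
      exact (card_pair hne).symm.le.trans (card_le_card hsub)
  have hterms : ∀ y ∈ S, (1 : ℝ) ≤ (12 : ℝ) - ((X.filter fun q => dist y q = 1).card : ℝ) := by
    intro y hy
    have : ((X.filter fun q => dist y q = 1).card : ℝ) ≤ 11 := by exact_mod_cast (mem_filter.1 hy).2.2
    linarith
  unfold pooledDef
  calc (2 : ℝ) ≤ (S.card : ℝ) := by exact_mod_cast hcard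
    _ = ∑ _y ∈ S, (1 : ℝ) := by simp
    _ ≤ ∑ y ∈ S, ((12 : ℝ) - ((X.filter fun q => dist y q = 1).card : ℝ)) := sum_le_sum hterms

section Functional

variable (cap : Finset (EuclideanSpace ℝ (Fin 3)) → EuclideanSpace ℝ (Fin 3) → ℕ)

open scoped Classical in
/-- **THE TWO-PAYER-FLOORED POOL**: `payerPool` at the payer itself, `max 2 payerPool` at every other ball. -/
def payerPool₂ (D : Finset (EuclideanSpace ℝ (Fin 3))) (z b : EuclideanSpace ℝ (Fin 3)) : ℝ :=
  if b = z then payerPool cap D z b else max 2 (payerPool cap D z b)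

open scoped Classical in
/-- **THE TWO-PAYER-FLOORED CAPPED (A)-SUMMAND** of the core `D` at the payer `z`. -/
def payerSummand₂ (v : WordVersion) (S₁ S₂ : PlateSystem) (D : Finset (EuclideanSpace ℝ (Fin 3))) (z : EuclideanSpace ℝ (Fin 3)) : ℝ :=
  ∑ b ∈ D.filter (fun b => dist z b ≤ 1 ∧ 0 < endMultA D v S₁ S₂ b), (endMultA D v S₁ S₂ b : ℝ) / payerPool₂ cap D z b

variable {cap}

open scoped Classical in
/-- The two-payer floor only raises the pool. -/
theorem payerPool_le_payerPool₂ (D : Finset (EuclideanSpace ℝ (Fin 3))) (z b : EuclideanSpace ℝ (Fin 3)) : payerPool cap D z b ≤ payerPool₂ cap D z b := by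
  unfold payerPool₂
  split_ifs
  · exact le_rfl
  · exact le_max_right _ _

/-- The two-payer-floored pool is positive. -/
theorem payerPool₂_pos (D : Finset (EuclideanSpace ℝ (Fin 3))) (z b : EuclideanSpace ℝ (Fin 3)) : 0 < payerPool₂ cap D z b :=
  lt_of_lt_of_le (payerPool_pos D z b) (payerPool_le_payerPool₂ D z b)

open scoped Classical in
/-- The two-payer-floored functional is at most the payer-floored one (same index set, larger denominators). -/
theorem payerSummand₂_le_payerSummand (v : WordVersion) (S₁ S₂ : PlateSystem) (D : Finset (EuclideanSpace ℝ (Fin 3))) (z : EuclideanSpace ℝ (Fin 3)) :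
    payerSummand₂ cap v S₁ S₂ D z ≤ payerSummand cap v S₁ S₂ D z := by
  unfold payerSummand₂ payerSummand
  exact sum_le_sum fun b _ => div_le_div_of_nonneg_left (Nat.cast_nonneg _) (payerPool_pos D z b) (payerPool_le_payerPool₂ D z b)

open scoped Classical in
/-- **The two-payer-floored pool never exceeds the true pool** at a ball `b` carrying the two-payer clause (every loaded ball does). -/
theorem payerPool₂_le_pooledDef {X D : Finset (EuclideanSpace ℝ (Fin 3))} (hX : ∀ p ∈ X, ∀ q ∈ X, p ≠ q → 1 ≤ dist p q) (hDX : D ⊆ X) {z : EuclideanSpace ℝ (Fin 3)}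
    (hjunk : ∀ y ∈ D, dist z y ≤ 2 → ((X \ D).filter fun x => dist y x = 1).card ≤ cap D y) (hz : z ∈ X) (hdeg : (X.filter fun q => dist z q = 1).card ≤ 11)
    {b : EuclideanSpace ℝ (Fin 3)} (hzb : dist z b ≤ 1) (hb : b ∈ X) (hpay : HasTwoPayers X b) : payerPool₂ cap D z b ≤ pooledDef X b := by
  unfold payerPool₂
  split_ifs with hbz
  · exact payerPool_le_pooledDef hX hDX hjunk hz hdeg hzb
  · exact max_le (two_le_pooledDef_of_hasTwoPayers hz hdeg hzb hbz hb hpay) (payerPool_le_pooledDef hX hDX hjunk hz hdeg hzb)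

end Functional

/-! ### The comparison with the two-payer floor -/

open scoped Classical in
/-- **`Σ_A(Y, z) ≤ payerSummand₂ capTable₃ (unionCoreStar Y z) z`** at every payer of degree `≤ 11` (under E1); no hypothesis on the core's pools. -/
theorem localSummandA_le_payerSummand₂_unionCoreStar (hE1 : P5Exhaustion) {Y : Finset (EuclideanSpace ℝ (Fin 3))}
    (hY : ∀ p ∈ Y, ∀ p' ∈ Y, p ≠ p' → 1 ≤ dist p p') {v : WordVersion} {S₁ S₂ : PlateSystem} (h₁ : S₁.RT ⊆ fccSlots) (h₂ : S₂.RT ⊆ fccSlots)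
    {z : EuclideanSpace ℝ (Fin 3)} (hz : z ∈ Y) (hdeg : (Y.filter fun q => dist z q = 1).card ≤ 11) :
    localSummandA v S₁ S₂ Y z ≤ payerSummand₂ capTable₃ v S₁ S₂ (unionCoreStar Y z v S₁ S₂) z := by
  set D := unionCoreStar Y z v S₁ S₂ with hDdef
  have hD : IsStarClosed Y z D := isStarClosed_unionCoreStar
  have hDY : D ⊆ Y := hD.subset
  have hjunk : ∀ y ∈ D, dist z y ≤ 2 → ((Y \ D).filter fun x => dist y x = 1).card ≤ capTable₃ D y :=
    fun y hy hzy => junkCapBoundStar_capTable₃ hE1 Y hY z D hD y hy hzy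
  unfold localSummandA payerSummand₂
  have hsub : Y.filter (fun b => dist z b ≤ 1 ∧ 0 < endMultA Y v S₁ S₂ b) ⊆ D.filter (fun b => dist z b ≤ 1 ∧ 0 < endMultA D v S₁ S₂ b) := by
    intro b hb
    obtain ⟨-, hzb, he⟩ := mem_filter.1 hb
    have hle : endMultA Y v S₁ S₂ b ≤ endMultA D v S₁ S₂ b := endMultA_le_unionCoreStar hY h₁ h₂ hzb
    obtain ⟨q, hq⟩ := card_pos.1 he
    have hpD := isEndPairA_unionCoreStar hY h₁ h₂ hzb (mem_filter.1 hq).2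
    exact mem_filter.2 ⟨hpD.2.1, hzb, lt_of_lt_of_le he hle⟩
  calc ∑ b ∈ Y.filter (fun b => dist z b ≤ 1 ∧ 0 < endMultA Y v S₁ S₂ b), (endMultA Y v S₁ S₂ b : ℝ) / pooledDef Y b
      ≤ ∑ b ∈ Y.filter (fun b => dist z b ≤ 1 ∧ 0 < endMultA Y v S₁ S₂ b), (endMultA D v S₁ S₂ b : ℝ) / payerPool₂ capTable₃ D z b := by
        refine sum_le_sum fun b hb => ?_
        obtain ⟨hbY, hzb, he⟩ := mem_filter.1 hb
        obtain ⟨q, hq⟩ := card_pos.1 he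
        have hpay : HasTwoPayers Y b := (mem_filter.1 hq).2.2.2.1
        exact div_le_div₀ (Nat.cast_nonneg _) (Nat.cast_le.2 (endMultA_le_unionCoreStar hY h₁ h₂ hzb)) (payerPool₂_pos D z b)
          (payerPool₂_le_pooledDef hY hDY hjunk hz hdeg hzb hbY hpay)
    _ ≤ ∑ b ∈ D.filter (fun b => dist z b ≤ 1 ∧ 0 < endMultA D v S₁ S₂ b), (endMultA D v S₁ S₂ b : ℝ) / payerPool₂ capTable₃ D z b :=
        sum_le_sum_of_subset_of_nonneg hsub fun b _ _ => div_nonneg (Nat.cast_nonneg _) (payerPool₂_pos D z b).le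


open scoped Classical in
/-- **STAR-CLOSED UNION-CORE CERTIFICATE, STANDARD FRAME (named input)**: for every `1`-separated `Y` and payer `z ∈ Y` of degree `≤ 11`, the two-payer-floored capped
(A)-summand (cap table `capTable₃`, version `v2`) of the star-closed union core of `z` for the STANDARD systems `basalSystem refl`, `basalSystem H` is `≤ s`. -/
def UnionCoreStarCapStd (s : ℝ) : Prop :=
  ∀ Y : Finset (EuclideanSpace ℝ (Fin 3)), (∀ p ∈ Y, ∀ q ∈ Y, p ≠ q → 1 ≤ dist p q) →
  ∀ z ∈ Y, (Y.filter fun q => dist z q = 1).card ≤ 11 →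
    payerSummand₂ capTable₃ WordVersion.v2 (basalSystem (LinearIsometryEquiv.refl ℝ (EuclideanSpace ℝ (Fin 3))))
      (basalSystem (ℝ ∙ EuclideanSpace.single (2 : Fin 3) (1 : ℝ)).reflection)
      (unionCoreStar Y z WordVersion.v2 (basalSystem (LinearIsometryEquiv.refl ℝ (EuclideanSpace ℝ (Fin 3))))
        (basalSystem (ℝ ∙ EuclideanSpace.single (2 : Fin 3) (1 : ℝ)).reflection)) z ≤ s

/-- Monotonicity in the line. -/
theorem unionCoreStarCapStd_mono {s s' : ℝ} (h : UnionCoreStarCapStd s) (hs : s ≤ s') : UnionCoreStarCapStd s' := fun Y hY z hz hdeg => (h Y hY z hz hdeg).trans hs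

/-- The all-frames payer-floored certificate ('…SeamPayerFloor') implies the standard-frame two-payer-floored one (instance `L = refl`, larger denominators). -/
theorem unionCoreStarCapStd_of_cap {s : ℝ} (h : UnionCoreStarCap s) : UnionCoreStarCapStd s := by
  intro Y hY z hz hdeg
  have h' := h (LinearIsometryEquiv.refl ℝ (EuclideanSpace ℝ (Fin 3))) Y hY z hz hdeg
  rw [LinearIsometryEquiv.trans_refl] at h'
  exact (payerSummand₂_le_payerSummand _ _ _ _ _).trans h'

/-! ### Transport to the standard frame -/

/-- A rigid image of a `1`-separated configuration is `1`-separated. -/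
theorem separated_image_rigid {Y : Finset (EuclideanSpace ℝ (Fin 3))} (hY : ∀ p ∈ Y, ∀ q ∈ Y, p ≠ q → 1 ≤ dist p q)
    (S : EuclideanSpace ℝ (Fin 3) ≃ₗᵢ[ℝ] EuclideanSpace ℝ (Fin 3)) (c : EuclideanSpace ℝ (Fin 3)) :
    ∀ p ∈ Y.image (fun x => S x + c), ∀ q ∈ Y.image (fun x => S x + c), p ≠ q → 1 ≤ dist p q := by
  intro p hp q hq hne
  obtain ⟨a, ha, rfl⟩ := mem_image.1 hp
  obtain ⟨b, hb, rfl⟩ := mem_image.1 hq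
  rw [dist_rigid]
  exact hY a ha b hb fun h => hne (by rw [h])

open scoped Classical in
/-- **`P5Exhaustion ⇒ UnionCoreStarCapStd s ⇒ Σ_A(Y, z) ≤ s` for EVERY frame `L`** (transport `Y` by `L⁻¹` to the standard frame). -/
theorem localSummandA_le_of_unionCoreStarCapStd (hE1 : P5Exhaustion) {s : ℝ} (h : UnionCoreStarCapStd s)
    (L : EuclideanSpace ℝ (Fin 3) ≃ₗᵢ[ℝ] EuclideanSpace ℝ (Fin 3)) {Y : Finset (EuclideanSpace ℝ (Fin 3))} (hY : ∀ p ∈ Y, ∀ q ∈ Y, p ≠ q → 1 ≤ dist p q)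
    {z : EuclideanSpace ℝ (Fin 3)} (hz : z ∈ Y) (hdeg : (Y.filter fun q => dist z q = 1).card ≤ 11) :
    localSummandA WordVersion.v2 (basalSystem L) (basalSystem (((ℝ ∙ EuclideanSpace.single (2 : Fin 3) (1 : ℝ)).reflection).trans L)) Y z ≤ s := by
  set H : EuclideanSpace ℝ (Fin 3) ≃ₗᵢ[ℝ] EuclideanSpace ℝ (Fin 3) := (ℝ ∙ EuclideanSpace.single (2 : Fin 3) (1 : ℝ)).reflection with hH
  set X := Y.image fun y => L.symm y + 0 with hXdef
  have hX : ∀ p ∈ X, ∀ q ∈ X, p ≠ q → 1 ≤ dist p q := separated_image_rigid hY L.symm 0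
  have hYX : Y = X.image fun x => L x + 0 := by
    have e := image_rigid_symm Y L.symm 0
    simp only [LinearIsometryEquiv.symm_symm, map_zero, neg_zero] at e
    rw [hXdef, e]
  have hz' : L.symm z + 0 ∈ X := mem_image_of_mem _ hz
  have hzz : z = L (L.symm z + 0) + 0 := by simp
  have hdeg' : (X.filter fun q => dist (L.symm z + 0) q = 1).card ≤ 11 := by
    rw [← degree_transport X L 0 (L.symm z + 0), ← hYX, ← hzz]; exact hdeg
  have h₁ : (basalSystem (LinearIsometryEquiv.refl ℝ (EuclideanSpace ℝ (Fin 3)))).RT ⊆ fccSlots := filter_subset _ _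
  have h₂ : (basalSystem H).RT ⊆ fccSlots := filter_subset _ _
  have key := localSummandA_transport X L 0 WordVersion.v2 (LinearIsometryEquiv.refl ℝ (EuclideanSpace ℝ (Fin 3))) H basalHexagon basalHexagon (L.symm z + 0)
  rw [← hYX, ← hzz, LinearIsometryEquiv.refl_trans] at key
  change localSummandA WordVersion.v2 ⟨L, basalHexagon⟩ ⟨H.trans L, basalHexagon⟩ Y z ≤ s
  rw [key]
  exact (localSummandA_le_payerSummand₂_unionCoreStar hE1 hX h₁ h₂ hz' hdeg').trans (h X hX _ hz' hdeg')

/-- **`P5Exhaustion ⇒ UnionCoreStarCapStd s ⇒ SeamResidual s k₀`.** -/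
theorem seamResidual_of_unionCoreStarCapStd (hE1 : P5Exhaustion) {s : ℝ} {k₀ : ℕ} (h : UnionCoreStarCapStd s) : SeamResidual s k₀ :=
  fun L _ hY _ hz hdeg _ _ _ _ => Or.inr (localSummandA_le_of_unionCoreStarCapStd hE1 h L hY hz hdeg)

/-- **`P5Exhaustion ⇒ UnionCoreStarCapStd s ⇒ CoherentSeamSmall s k₀`.** -/
theorem coherentSeamSmall_of_unionCoreStarCapStd (hE1 : P5Exhaustion) {s : ℝ} {k₀ : ℕ} (h : UnionCoreStarCapStd s) : CoherentSeamSmall s k₀ :=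
  fun L _ hY _ hz hdeg _ _ _ _ _ => Or.inr (localSummandA_le_of_unionCoreStarCapStd hE1 h L hY hz hdeg)

/-- **`P5Exhaustion ⇒ UnionCoreStarCapStd s ⇒ IncoherentSeamSmall s k₀`.** -/
theorem incoherentSeamSmall_of_unionCoreStarCapStd (hE1 : P5Exhaustion) {s : ℝ} {k₀ : ℕ} (h : UnionCoreStarCapStd s) : IncoherentSeamSmall s k₀ :=
  fun L _ hY _ hz hdeg _ _ _ _ _ => Or.inr (localSummandA_le_of_unionCoreStarCapStd hE1 h L hY hz hdeg)

/-- **The by-name closers' shape (frame-free)**: `stub_E1 : P5Exhaustion` and `UnionCoreStarCapStd (2√6)` close both T5b stubs at `k₀ = 3`. -/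
theorem t5b_of_unionCoreStarCapStd (hE1 : P5Exhaustion) (h : UnionCoreStarCapStd (2 * Real.sqrt 6)) :
    CoherentSeamSmall (2 * Real.sqrt 6) 3 ∧ IncoherentSeamSmall (2 * Real.sqrt 6) 3 :=
  ⟨coherentSeamSmall_of_unionCoreStarCapStd hE1 h, incoherentSeamSmall_of_unionCoreStarCapStd hE1 h⟩

/-! ### The window form: payer at the origin, configuration inside `B̄(0, 3)` -/

open scoped Classical in
/-- **STAR-CLOSED UNION-CORE CERTIFICATE, WINDOW FORM (named input; the certificate's literal universe)**: for every finite `1`-separated `Y ⊆ B̄(0, 3)` containing the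
payer `0` with degree `≤ 11`, the two-payer-floored capped (A)-summand (cap table `capTable₃`, `v2`, STANDARD systems) of the star-closed union core of `0` is `≤ s`. -/
def UnionCoreStarCapWin (s : ℝ) : Prop :=
  ∀ Y : Finset (EuclideanSpace ℝ (Fin 3)), (∀ y ∈ Y, dist (0 : EuclideanSpace ℝ (Fin 3)) y ≤ 3) → (∀ p ∈ Y, ∀ q ∈ Y, p ≠ q → 1 ≤ dist p q) →
  (0 : EuclideanSpace ℝ (Fin 3)) ∈ Y → (Y.filter fun q => dist (0 : EuclideanSpace ℝ (Fin 3)) q = 1).card ≤ 11 →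
    payerSummand₂ capTable₃ WordVersion.v2 (basalSystem (LinearIsometryEquiv.refl ℝ (EuclideanSpace ℝ (Fin 3))))
      (basalSystem (ℝ ∙ EuclideanSpace.single (2 : Fin 3) (1 : ℝ)).reflection)
      (unionCoreStar Y 0 WordVersion.v2 (basalSystem (LinearIsometryEquiv.refl ℝ (EuclideanSpace ℝ (Fin 3))))
        (basalSystem (ℝ ∙ EuclideanSpace.single (2 : Fin 3) (1 : ℝ)).reflection)) 0 ≤ s

/-- Monotonicity in the line. -/
theorem unionCoreStarCapWin_mono {s s' : ℝ} (h : UnionCoreStarCapWin s) (hs : s ≤ s') : UnionCoreStarCapWin s' :=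
  fun Y hW hY h0 hdeg => (h Y hW hY h0 hdeg).trans hs

/-- The standard-frame certificate implies the window form (instance `z = 0`). -/
theorem unionCoreStarCapWin_of_std {s : ℝ} (h : UnionCoreStarCapStd s) : UnionCoreStarCapWin s := fun Y _ hY h0 hdeg => h Y hY 0 h0 hdeg

open scoped Classical in
/-- **`P5Exhaustion ⇒ UnionCoreStarCapWin s ⇒ Σ_A(Y, z) ≤ s` for EVERY frame and EVERY payer** (transport `z ↦ 0`, `L ↦ refl`, then restrict to the window
`B̄(0, 3)`: the (A)-summand at the payer depends only on the balls within `3`). -/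
theorem localSummandA_le_of_unionCoreStarCapWin (hE1 : P5Exhaustion) {s : ℝ} (h : UnionCoreStarCapWin s)
    (L : EuclideanSpace ℝ (Fin 3) ≃ₗᵢ[ℝ] EuclideanSpace ℝ (Fin 3)) {Y : Finset (EuclideanSpace ℝ (Fin 3))} (hY : ∀ p ∈ Y, ∀ q ∈ Y, p ≠ q → 1 ≤ dist p q)
    {z : EuclideanSpace ℝ (Fin 3)} (hz : z ∈ Y) (hdeg : (Y.filter fun q => dist z q = 1).card ≤ 11) :
    localSummandA WordVersion.v2 (basalSystem L) (basalSystem (((ℝ ∙ EuclideanSpace.single (2 : Fin 3) (1 : ℝ)).reflection).trans L)) Y z ≤ s := by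
  set H : EuclideanSpace ℝ (Fin 3) ≃ₗᵢ[ℝ] EuclideanSpace ℝ (Fin 3) := (ℝ ∙ EuclideanSpace.single (2 : Fin 3) (1 : ℝ)).reflection with hH
  -- transport `z ↦ 0`, `L ↦ refl`
  set X := Y.image fun y => L.symm y + -L.symm z with hXdef
  have hX : ∀ p ∈ X, ∀ q ∈ X, p ≠ q → 1 ≤ dist p q := separated_image_rigid hY L.symm _
  have hYX : Y = X.image fun x => L x + z := by
    have e := image_rigid_symm Y L.symm (-L.symm z)
    simp only [LinearIsometryEquiv.symm_symm, map_neg, LinearIsometryEquiv.apply_symm_apply, neg_neg] at e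
    rw [hXdef, e]
  have h0 : (0 : EuclideanSpace ℝ (Fin 3)) ∈ X := mem_image.2 ⟨z, hz, by simp⟩
  have hzz : z = L 0 + z := by simp
  have hdeg0 : (X.filter fun q => dist (0 : EuclideanSpace ℝ (Fin 3)) q = 1).card ≤ 11 := by
    rw [← degree_transport X L z 0, ← hYX, ← hzz]; exact hdeg
  have key := localSummandA_transport X L z WordVersion.v2 (LinearIsometryEquiv.refl ℝ (EuclideanSpace ℝ (Fin 3))) H basalHexagon basalHexagon 0
  rw [← hYX, ← hzz, LinearIsometryEquiv.refl_trans] at key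
  change localSummandA WordVersion.v2 ⟨L, basalHexagon⟩ ⟨H.trans L, basalHexagon⟩ Y z ≤ s
  rw [key]
  -- restrict to the window `B̄(0, 3)`
  set X₀ := X.filter fun x => dist (0 : EuclideanSpace ℝ (Fin 3)) x ≤ 3 with hX₀def
  have hagree : ∀ x, dist (0 : EuclideanSpace ℝ (Fin 3)) x ≤ 3 → (x ∈ X ↔ x ∈ X₀) := fun x hx => by
    rw [hX₀def, mem_filter]; exact ⟨fun h => ⟨h, hx⟩, fun h => h.1⟩
  have h₁ : (basalSystem (LinearIsometryEquiv.refl ℝ (EuclideanSpace ℝ (Fin 3)))).RT ⊆ fccSlots := filter_subset _ _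
  have h₂ : (basalSystem H).RT ⊆ fccSlots := filter_subset _ _
  have hloc := localSummandA_congr_of_agree (v := WordVersion.v2) hagree h₁ h₂ (z := 0) (by simp)
  change localSummandA WordVersion.v2 (basalSystem (LinearIsometryEquiv.refl ℝ (EuclideanSpace ℝ (Fin 3)))) (basalSystem H) X 0 ≤ s
  rw [hloc]
  have hX₀ : ∀ p ∈ X₀, ∀ q ∈ X₀, p ≠ q → 1 ≤ dist p q := fun p hp q hq hne => hX p (mem_filter.1 hp).1 q (mem_filter.1 hq).1 hne
  have hW : ∀ y ∈ X₀, dist (0 : EuclideanSpace ℝ (Fin 3)) y ≤ 3 := fun y hy => (mem_filter.1 hy).2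
  have h00 : (0 : EuclideanSpace ℝ (Fin 3)) ∈ X₀ := mem_filter.2 ⟨h0, by simp⟩
  have hdeg00 : (X₀.filter fun q => dist (0 : EuclideanSpace ℝ (Fin 3)) q = 1).card ≤ 11 := by
    rw [← degree_congr_of_agree hagree (y := 0) (by simp)]; exact hdeg0
  exact (localSummandA_le_payerSummand₂_unionCoreStar hE1 hX₀ h₁ h₂ h00 hdeg00).trans (h X₀ hW hX₀ h00 hdeg00)

/-- The window form implies the standard-frame form (and conversely, above): they are the same certificate. -/
theorem seamResidual_of_unionCoreStarCapWin (hE1 : P5Exhaustion) {s : ℝ} {k₀ : ℕ} (h : UnionCoreStarCapWin s) : SeamResidual s k₀ :=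
  fun L _ hY _ hz hdeg _ _ _ _ => Or.inr (localSummandA_le_of_unionCoreStarCapWin hE1 h L hY hz hdeg)

/-- **`P5Exhaustion ⇒ UnionCoreStarCapWin s ⇒ CoherentSeamSmall s k₀`.** -/
theorem coherentSeamSmall_of_unionCoreStarCapWin (hE1 : P5Exhaustion) {s : ℝ} {k₀ : ℕ} (h : UnionCoreStarCapWin s) : CoherentSeamSmall s k₀ :=
  fun L _ hY _ hz hdeg _ _ _ _ _ => Or.inr (localSummandA_le_of_unionCoreStarCapWin hE1 h L hY hz hdeg)

/-- **`P5Exhaustion ⇒ UnionCoreStarCapWin s ⇒ IncoherentSeamSmall s k₀`.** -/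
theorem incoherentSeamSmall_of_unionCoreStarCapWin (hE1 : P5Exhaustion) {s : ℝ} {k₀ : ℕ} (h : UnionCoreStarCapWin s) : IncoherentSeamSmall s k₀ :=
  fun L _ hY _ hz hdeg _ _ _ _ _ => Or.inr (localSummandA_le_of_unionCoreStarCapWin hE1 h L hY hz hdeg)

/-- **The by-name closers' shape (window form)**: `stub_E1 : P5Exhaustion` and `UnionCoreStarCapWin (2√6)` close both T5b stubs at `k₀ = 3`. -/
theorem t5b_of_unionCoreStarCapWin (hE1 : P5Exhaustion) (h : UnionCoreStarCapWin (2 * Real.sqrt 6)) :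
    CoherentSeamSmall (2 * Real.sqrt 6) 3 ∧ IncoherentSeamSmall (2 * Real.sqrt 6) 3 :=
  ⟨coherentSeamSmall_of_unionCoreStarCapWin hE1 h, incoherentSeamSmall_of_unionCoreStarCapWin hE1 h⟩

end TailResidue

end Summit.Ventures.Crystal3D.Theorems

end
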